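import Summits.NavierStokesRegularity.NavierStokesRegularity.Theses.FilamentSkeletonRss
import Summits.NavierStokesRegularity.NavierStokesRegularity.Theses.CorkscrewDynamo
import Literature.Analysis.FluidPDE.TypeIAncientMild
import Literature.Analysis.FluidPDE.NSLerayHopfSereginEnergyProofs
import Summits.NavierStokesRegularity.NavierStokesRegularity.Theorems.FilamentSkeletonRssRdssProfileTruncationRescale
import Summits.NavierStokesRegularity.NavierStokesRegularity.Theorems.FilamentSkeletonRssRdssProfileTruncationClassicalPackage
import Summits.NavierStokesRegularity.NavierStokesRegularity.Theorems.FilamentSkeletonRssRdssProfileTruncationSmoothRepresentative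
import Summits.NavierStokesRegularity.NavierStokesRegularity.Theorems.FilamentSkeletonRssRdssProfileTruncationLerayHopfFinalSlice
import Summits.NavierStokesRegularity.NavierStokesRegularity.Theorems.FilamentSkeletonRssRdssProfileTruncationPseudoStableSteering
import Summits.NavierStokesRegularity.NavierStokesRegularity.Theorems.FilamentSkeletonRssRdssProfileTruncationPeriodPackage
import Summits.NavierStokesRegularity.NavierStokesRegularity.Theorems.FilamentSkeletonRssRdssProfileTruncationSlabFlow
import HarnessLib

/-!
# Route `FilamentSkeletonRss`, crux `RdssProfileTruncation` (stmt-NavierStokesRegularity-11289) —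
  ASSEMBLY of line `Sketch` (idea `subcritical-quasicompact-steering`, merged with the twin card
  `subcritical-pseudostable-shooting`: same lever); all seven registered stubs have landed in their
  own `Theorems/FilamentSkeletonRssRdssProfileTruncation<Stub>.lean` files and are composed here by name

`filamentSkeletonRss_rdssProfileTruncation_proof :
  Summit.NavierStokesRegularity.NavierStokesRegularity.Theses.FilamentSkeletonRss.RdssProfileTruncation`:
a nontrivial Type-I rotated-DSS ancient mild solution `u` (`ν = 1`, factor `c > 1`, isometry `R`)
yields a compactly supported smooth solenoidal datum whose Leray–Hopf classical solution has finite
maximal lifespan (X5a with `ν = 1`, `T = 1`).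

Mechanism (discrete renormalisation in the subcritical space `C₀,σ`; no hyperbolicity hypothesis).
Let `U = u(−1)` after normalisation.  The period map `𝓡 = 𝒮⁻¹ ∘ Φ_NS[−1 → −c⁻²]`
(`𝒮⁻¹ g = c⁻¹ R g(c⁻¹ R⁻¹ ·)` the zoom-out) is a smooth self-map of a sup-norm ball of perturbations
`g` of `U` inside the Banach space `F` of continuous solenoidal fields vanishing at infinity, with
`𝓡(U) = U` (rotated DSS) and `D𝓡(U) = S + K`: `S = 𝒮⁻¹ ∘ e^{(1−c⁻²)Δ}` has `‖Sⁿ‖ ≤ c⁻ⁿ` (the heat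
flow is a sup-norm contraction and the zoom-out has norm exactly `c⁻¹`: SUBCRITICALITY), and the
Duhamel part `K` is COMPACT because the coefficient `|u| ≤ C₀/(|x| + √−t)` vanishes at infinity
(Type I).  Hence `D𝓡(U)` is quasi-compact, a Lyapunov–Perron pseudo-stable manifold of finite
codimension through `U` exists at every non-resonant rate `θ ∈ (c⁻¹, 1)`, and a finite-parameter
family of compactly supported solenoidal correctors added to the solenoidal truncation `ψ_L(U)`
(sup-distance `O(C₀/L)` from `U`) is steered onto it (abstract stub `stub_pseudoStableSteering`).
The steered datum's orbit stays sup-close to `U` period after period, so the concatenated physical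
solution is unbounded at `(t, x) → (1, 0)` while bounded on every `[0, 1 − δ]`; it is classical and
Leray–Hopf (Oseen-gauge packaging over the tree's KNSS/Tao/Kato theories), maximal by unboundedness
near a point, and the datum is `C_c^∞`, hence rapidly decaying.

Stubs (registered; each landed in its own `Theorems/FilamentSkeletonRssRdssProfileTruncation<Stub>.lean`
with `--supports stmt-NavierStokesRegularity-11289`):
1. `stub_rdssSmoothRepresentative` — duality-form Type-I RDSS profile ⇒ smooth Oseen-gauge
   representative (`IsTypeIAncientMild`), still RDSS / Type I, nontrivial at a point.
2. `stub_rdssRescale` — parabolic rescaling puts the nontrivial slice at `t = −1` (same `c`, `R`).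
3a. `stub_rdssSlabFlow` — THE NEW HARD ANALYSIS: the one-period flow of sup-small perturbations
   of the profile (solution operator, Lipschitz, strict derivative = heat + compact part `Klin`).
3b. `stub_rdssPeriodPackage` — given 3a, the period-map package on a Banach space `E` of
   continuous solenoidal fields vanishing at infinity (quasi-compact derivative, truncation data,
   dense `C_c,σ^∞` directions) and the physical semantics of a trapped orbit: an Oseen-mild
   solution on `[0,1)` unbounded at `(1, 0)`.
4. `stub_pseudoStableSteering` — abstract Banach-space theorem: contraction-power + compact
   derivative, dense directions ⇒ some corrected small datum has a trapped orbit.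
5. `stub_oseenClassicalPackage` — an Oseen-mild, locally bounded, continuous solution from a `C_c^∞`
   solenoidal datum is classical on `[0,T)` and Leray–Hopf on every `[0,T']`, `T' < T`.
6. `stub_lerayHopfFinalSlice` — Leray–Hopf on every `[0,T')` ⇒ Leray–Hopf on `[0,T]` after
   redefining the slice at `T` (weak `L²` limit).
Inline (proved here): maximality from unboundedness near a point; transfer of classical solutions
along equality on `[0,T)`; rapid decay of `C_c^∞` data is the tree's
`HasRapidSpatialDecay.of_hasCompactSupport`.
-/

noncomputable section

open MeasureTheory Set Filter Topology Function
open scoped RealInnerProductSpace ContDiff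

set_option linter.dupNamespace false

namespace Summit.NavierStokesRegularity.NavierStokesRegularity.Theorems

open Literature.Analysis.FluidPDE

/-- Physical space `ℝ³`. -/
local notation "ℝ³" => EuclideanSpace ℝ (Fin 3)

/-! ## The stubs -/

-- stub_rdssSmoothRepresentative: LANDED (p130651) in Theorems/FilamentSkeletonRssRdssProfileTruncationSmoothRepresentative.lean

-- stub_rdssRescale: LANDED (p129639) in Theorems/FilamentSkeletonRssRdssProfileTruncationRescale.lean

-- stub_rdssSlabFlow: LANDED in Theorems/FilamentSkeletonRssRdssProfileTruncationSlabFlow.lean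

-- stub_rdssPeriodPackage: LANDED (p131743) in Theorems/FilamentSkeletonRssRdssProfileTruncationPeriodPackage.lean

-- stub_pseudoStableSteering: LANDED (p131446) in Theorems/FilamentSkeletonRssRdssProfileTruncationPseudoStableSteering.lean

-- stub_oseenClassicalPackage: LANDED (p130116) in Theorems/FilamentSkeletonRssRdssProfileTruncationClassicalPackage.lean

-- stub_lerayHopfFinalSlice: LANDED (p130536) in Theorems/FilamentSkeletonRssRdssProfileTruncationLerayHopfFinalSlice.lean

/-! ## Inline lemmas (proved) -/

/-- Transfer of a classical solution on `[0, T)` along an equality of velocities on `[0, T)`: the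
one-sided time derivative within `Ico 0 T`, the spatial operators and the joint smoothness on
`Ico 0 T × ℝ³` only see the values on `[0, T)`. [folklore] -/
theorem isClassicalNSSolutionOn_Ico_congr {ν T : ℝ} {f w w' : ℝ → ℝ³ → ℝ³} {q : ℝ → ℝ³ → ℝ}
    (h : IsClassicalNSSolutionOn (Ico 0 T) ν f w q) (heq : ∀ t ∈ Ico 0 T, w' t = w t) :
    IsClassicalNSSolutionOn (Ico 0 T) ν f w' q where
  smooth_velocity := by
    refine h.smooth_velocity.congr ?_
    rintro ⟨t, x⟩ ⟨ht, -⟩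
    simp [uncurry, heq t ht]
  smooth_pressure := h.smooth_pressure
  momentum t ht x := by
    have hd : timeDerivWithin (Ico 0 T) w' t x = timeDerivWithin (Ico 0 T) w t x := by
      simp only [timeDerivWithin_apply]
      exact derivWithin_congr (fun s hs => by rw [heq s hs]) (by rw [heq t ht])
    rw [hd, heq t ht]
    exact h.momentum t ht x
  divFree t ht := by
    rw [heq t ht]
    exact h.divFree t ht

/-- **Maximality from unboundedness near a point.**  A classical solution on `[0, T)` which is
unbounded as `(t, x) → (T, 0)` has no classical extension to any `[0, T')`, `T' > T`: such an
extension is continuous on the compact set `[0, T] × B̄(0, 1)`, hence bounded there, and agrees with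
the solution on `[0, T)`. [cite: BealeKatoMajda1984, §1] -/
theorem isMaximalSmoothSolution_of_unbounded_near {ν T : ℝ} {f w : ℝ → ℝ³ → ℝ³} {q : ℝ → ℝ³ → ℝ}
    (h : IsClassicalNSSolutionOn (Ico 0 T) ν f w q)
    (hunb : ∀ K δ : ℝ, 0 < δ → ∃ t ∈ Ico 0 T, ∃ x : ℝ³, T - δ < t ∧ ‖x‖ < δ ∧ K < ‖w t x‖) :
    IsMaximalSmoothSolution ν f w q T := by
  refine ⟨h, ?_⟩
  rintro ⟨T', hT', u', p', hcl', hagree⟩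
  -- `u'` is continuous on the compact `[0, T] × B̄(0,1) ⊆ [0, T') × ℝ³`, hence bounded there
  have hcont : ContinuousOn (uncurry u') (Icc 0 T ×ˢ Metric.closedBall (0 : ℝ³) 1) :=
    hcl'.smooth_velocity.continuousOn.mono
      (prod_mono (fun t ht => ⟨ht.1, lt_of_le_of_lt ht.2 hT'⟩) (subset_univ _))
  have hcpt : IsCompact (Icc (0 : ℝ) T ×ˢ Metric.closedBall (0 : ℝ³) 1) :=
    isCompact_Icc.prod (isCompact_closedBall 0 1)
  obtain ⟨K, hK⟩ := hcpt.exists_bound_of_continuousOn hcont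
  obtain ⟨t, ht, x, -, hx, hKt⟩ := hunb K 1 one_pos
  have hmem : (t, x) ∈ Icc (0 : ℝ) T ×ˢ Metric.closedBall (0 : ℝ³) 1 :=
    ⟨⟨ht.1, ht.2.le⟩, by simpa [Metric.mem_closedBall, dist_zero_right] using hx.le⟩
  have h1 := hK (t, x) hmem
  rw [uncurry_apply_pair, hagree t ht] at h1
  exact absurd h1 (not_le.2 hKt)

/-! ## Assembly -/

/-- **`RdssProfileTruncation` holds** (line `Sketch` = subcritical quasi-compact steering): composition
of the six stubs.  Normalise the profile (smooth Oseen gauge, nontrivial slice at `t = −1`); take the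
period-map package; complete `F`; steer a truncation datum of norm `< r(η₀)` by a dense-direction
corrector onto a trapped orbit (abstract pseudo-stable steering); read off the physical solution on
`[0, 1)` (Oseen-mild, unbounded at `(1, 0)`); package it as classical + Leray–Hopf on sub-slabs, add
the final weak slice, transfer classicality along the equality on `[0, 1)`, conclude maximality from
unboundedness and rapid decay from compact support; `ν = 1`, `T = 1`. [cite: KochNadirashviliSereginSverak2009, §4; HirschPughShub1977, Thm 5.1] -/
theorem filamentSkeletonRss_rdssProfileTruncation_proof :
    Summit.NavierStokesRegularity.NavierStokesRegularity.Theses.FilamentSkeletonRss.RdssProfileTruncation := by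
  rintro ⟨c, R, u, hc, hmild, hmeas, hrdss, hTypeI, hnz⟩
  -- normalisation
  obtain ⟨u₁, C, C₀, t₀, x₀, hK₁, hrdss₁, hdec₁, ht₀, hx₀⟩ :=
    stub_rdssSmoothRepresentative c R u hc hmild hmeas hrdss hTypeI hnz
  obtain ⟨u₂, y₀, hK₂, hrdss₂, hdec₂, hy₀⟩ :=
    stub_rdssRescale C C₀ c t₀ R u₁ x₀ hK₁ hrdss₁ hdec₁ ht₀ hx₀
  -- the period-map package
  obtain ⟨E, _, _, _, ι, D, T, M, S, K, hD, hDnice, hMSK, hKc, ⟨Cs, θ₀, hθ₀, hθ₁, hS⟩, hT0, hTd,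
    htrunc, η₀, hη₀, hsem⟩ := stub_rdssPeriodPackage C C₀ c R u₂ y₀ hK₂ hrdss₂ hc hdec₂ hy₀
      (stub_rdssSlabFlow C C₀ c R u₂ hK₂ hrdss₂ hc hdec₂)
  -- abstract steering at radius η₀
  obtain ⟨r, hr, hsteer⟩ :=
    stub_pseudoStableSteering E T M S K D Cs θ₀ hMSK hKc hθ₀ hθ₁ hS hT0 hTd hD η₀ hη₀
  obtain ⟨e, he, hsm_e, hcs_e, hdiv_e⟩ := htrunc r hr
  obtain ⟨d, hd, horbit⟩ := hsteer e he
  obtain ⟨hsm_d, hcs_d, hdiv_d⟩ := hDnice d hd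
  -- the physical solution on [0, 1)
  obtain ⟨v, hv0, hvcont, hvdiv, hvoseen, hvbdd, hvunb⟩ := hsem (e + d) horbit
  -- the datum is smooth, compactly supported and divergence free
  have hdat : v 0 = (u₂ (-1) + ι e) + ι d := by rw [hv0, map_add, add_assoc]
  have hsm : ContDiff ℝ ∞ (v 0) := by rw [hdat]; exact hsm_e.add hsm_d
  have hcs : HasCompactSupport (v 0) := by rw [hdat]; exact hcs_e.add hcs_d
  have hdiv : VectorCalculus.IsDivFree (v 0) := by
    rw [hdat]
    intro x
    have h1 := hdiv_e x
    have h2 := hdiv_d x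
    simp only [VectorCalculus.divergence] at h1 h2 ⊢
    rw [fderiv_add ((hsm_e.differentiable (by simp)).differentiableAt)
      ((hsm_d.differentiable (by simp)).differentiableAt)]
    simp [map_add, h1, h2]
  -- classical + Leray–Hopf packaging
  obtain ⟨w, q, hwv, hwcl, hwLH⟩ :=
    stub_oseenClassicalPackage 1 v one_pos hsm hcs hdiv hvcont hvdiv hvoseen hvbdd
  obtain ⟨w', hw'w, hLH⟩ := stub_lerayHopfFinalSlice 1 1 (v 0) w one_pos one_pos hwLH
  have hcl' : IsClassicalNSSolutionOn (Ico 0 1) 1 0 w' q := isClassicalNSSolutionOn_Ico_congr hwcl hw'w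
  have h0 : (0 : ℝ) ∈ Ico (0 : ℝ) 1 := ⟨le_rfl, one_pos⟩
  have hw'0 : w' 0 = v 0 := by rw [hw'w 0 h0, hwv 0 h0]
  -- maximality from unboundedness at (1, 0)
  have hunb' : ∀ K δ : ℝ, 0 < δ → ∃ t ∈ Ico (0 : ℝ) 1, ∃ x : ℝ³, 1 - δ < t ∧ ‖x‖ < δ ∧ K < ‖w' t x‖ := by
    intro K δ hδ
    obtain ⟨t, ht, x, h1, h2, h3⟩ := hvunb K δ hδ
    exact ⟨t, ht, x, h1, h2, by rwa [hw'w t ht, hwv t ht]⟩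
  have hmax : IsMaximalSmoothSolution 1 0 w' q 1 := isMaximalSmoothSolution_of_unbounded_near hcl' hunb'
  refine ⟨1, one_pos, 1, one_pos, w', q, hmax, ?_, ?_⟩
  · rw [hw'0]; exact hLH
  · rw [hw'0]; exact HasRapidSpatialDecay.of_hasCompactSupport hsm hcs

/-- **`RdssProfileTruncation` holds, `CorkscrewDynamo` copy** (stmt-NavierStokesRegularity-11289 is
shared verbatim by routes `CorkscrewDynamo` and `FilamentSkeletonRss`; the two route decls have the
same body, so the proof transfers definitionally). [cite: KochNadirashviliSereginSverak2009, §4; HirschPughShub1977, Thm 5.1] -/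
theorem RdssProfileTruncation_proof :
    Summit.NavierStokesRegularity.NavierStokesRegularity.Theses.CorkscrewDynamo.RdssProfileTruncation :=
  filamentSkeletonRss_rdssProfileTruncation_proof

end Summit.NavierStokesRegularity.NavierStokesRegularity.Theorems

end
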